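import Literature.AlgebraicGeometry.Motives.FiniteQuotientQuasiProjective
import HarnessLib

/-!
# Separated quotients are transported along EQUIVARIANT isomorphisms of the source
# (Mumford, *Abelian Varieties*, §7 Thm. p. 66, Remark: the quotient is categorical)

Topic `AlgebraicGeometry/Motives`; namespace `Literature.AlgebraicGeometry.Motives`. Bookkeeping for the tree's predicate
`Motives.IsSepQuotient act p` («`p : Y ⟶ Z` is a quotient of `Y` by the `k`-automorphisms `act g` for separated test objects»,
`Motives/SeparatedQuotient`), complementing `IsSepQuotient.of_comp_iso` (isomorphisms of the TARGET, `FiniteQuotientBaseChange`):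

* `IsSepQuotient.precomp_iso` — if `e : Y ≅ Y'` intertwines actions `act` on `Y` and `act'` on `Y'` and `p : Y' ⟶ Z` is a quotient
  for `act'`, then `e.hom ≫ p` is a quotient for `act` (an equivariant isomorphism of the source changes nothing);
* `exists_iso_finiteQuotient_of_equivariant_iso` — hence the tree's finite quotients of `Y` and `Y'` (Mumford's covering hypothesis on
  both) are isomorphic compatibly with the quotient maps.

Use (cell `hodgecm-mathlib`, I-1′ `stub_Squot`, RECEPTACLE-PLAN §7.2 Step D): transport the Hecke action and its quotient along the
tower isomorphism `R.e : Nm ⊗_ℚ ℂ ≅ Sg.Mc` of a Siegel rational model. Everything is proved; no definitions, no named facts.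

## References
* [MumfordAV1970] D. Mumford, *Abelian Varieties* (1970), §7 Thm. p. 66 (Remark).
-/

noncomputable section

open CategoryTheory CategoryTheory.Limits AlgebraicGeometry
open Literature.AlgebraicGeometry.RelativeSpec

universe u v

namespace Literature.AlgebraicGeometry.Motives

section Predicate

variable {k : Type u} [Field k] {Δ : Type v} {Y Y' Z : SchemeOver k}

/-- **An equivariant isomorphism of the source preserves separated quotients**: if `e : Y ≅ Y'` satisfies
`e.hom ≫ act' g = act g ≫ e.hom` for all `g` and `p : Y' ⟶ Z` is a quotient of `Y'` by the `act' g` for separated test objects, then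
`e.hom ≫ p` is a quotient of `Y` by the `act g` (invariant test morphisms out of `Y` correspond to those out of `Y'` under `e`).
[cite: MumfordAV1970, §7 Thm. p. 66 (Remark)] -/
theorem IsSepQuotient.precomp_iso {act : Δ → (Y ≅ Y)} {act' : Δ → (Y' ≅ Y')} (e : Y ≅ Y')
    (he : ∀ g : Δ, e.hom ≫ (act' g).hom = (act g).hom ≫ e.hom) {p : Y' ⟶ Z} (h : IsSepQuotient act' p) :
    IsSepQuotient act (e.hom ≫ p) := by
  have he' : ∀ g : Δ, (act g).hom ≫ e.hom = e.hom ≫ (act' g).hom := fun g => (he g).symm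
  have he'' : ∀ g : Δ, e.inv ≫ (act g).hom = (act' g).hom ≫ e.inv := fun g => by
    rw [Iso.inv_comp_eq, ← Category.assoc, he, Category.assoc, Iso.hom_inv_id, Category.comp_id]
  refine ⟨fun g => ?_, fun W f hW hf => ?_⟩
  · rw [← Category.assoc, he', Category.assoc, h.hom_comp g]
  · have hf' : ∀ g : Δ, (act' g).hom ≫ e.inv ≫ f = e.inv ≫ f := fun g => by
      rw [← Category.assoc, ← he'' g, Category.assoc, hf g]
    obtain ⟨fbar, hfbar, huniq⟩ := h.existsUnique (e.inv ≫ f) hW hf'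
    refine ⟨fbar, ?_, fun c hc => huniq c ?_⟩
    · change (e.hom ≫ p) ≫ fbar = f
      rw [Category.assoc, hfbar, Iso.hom_inv_id_assoc]
    · change (e.hom ≫ p) ≫ c = f at hc
      rw [Iso.eq_inv_comp, ← hc, Category.assoc]

end Predicate

section FiniteQuotient

variable {k : Type u} [Field k] {Δ : Type} [Group Δ] [Finite Δ] {Y Y' : SchemeOver k}
  [IsSeparated Y.hom] [IsSeparated Y'.hom]

set_option backward.isDefEq.respectTransparency false

/-- A `k`-scheme with separated structure map is a separated scheme. [folklore] -/
private theorem isSeparated_left_of_isSeparated_hom''' (W : SchemeOver k) (hW : IsSeparated W.hom) :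
    W.left.IsSeparated :=
  ⟨by rw [← terminal.comp_from W.hom]; infer_instance⟩

/-- **The finite quotients of equivariantly isomorphic sources are isomorphic under the quotient maps** (`Y`, `Y'` separated with
Mumford's covering hypothesis for the actions `act`, `act'`; `e : Y ≅ Y'` equivariant): there is `i : Y/Δ ≅ Y'/Δ` with
`π_Y ≫ i.hom = e.hom ≫ π_{Y'}` (`IsSepQuotient.precomp_iso` + uniqueness of separated quotients
`isoFiniteQuotient_of_isSepQuotient_of_cover`). [cite: MumfordAV1970, §7 Thm. p. 66 (Remark)] -/
theorem exists_iso_finiteQuotient_of_equivariant_iso (act : Δ →* Aut Y) (act' : Δ →* Aut Y')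
    (hcov : ∀ y : Y.left, ∃ O : (⟨((Over.forget _).mapAut Y).comp act, fun g => Over.w (act g).hom⟩ :
        ActionOver Y.hom Δ).StableAffineOpens, y ∈ O.1)
    (hcov' : ∀ y : Y'.left, ∃ O : (⟨((Over.forget _).mapAut Y').comp act', fun g => Over.w (act' g).hom⟩ :
        ActionOver Y'.hom Δ).StableAffineOpens, y ∈ O.1)
    (e : Y ≅ Y') (he : ∀ g : Δ, e.hom ≫ (act' g).hom = (act g).hom ≫ e.hom) :
    ∃ i : finiteQuotient (⟨((Over.forget _).mapAut Y').comp act', fun g => Over.w (act' g).hom⟩ : ActionOver Y'.hom Δ) ≅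
        finiteQuotient (⟨((Over.forget _).mapAut Y).comp act, fun g => Over.w (act g).hom⟩ : ActionOver Y.hom Δ),
      (e.hom ≫ finiteQuotient.mk _ hcov') ≫ i.hom = finiteQuotient.mk _ hcov := by
  have hq : IsSepQuotient (fun g => act g) (e.hom ≫ finiteQuotient.mk _ hcov') :=
    IsSepQuotient.precomp_iso e he (isSepQuotient_finiteQuotientMk act' hcov')
  exact isoFiniteQuotient_of_isSepQuotient_of_cover act hcov (e.hom ≫ finiteQuotient.mk _ hcov')
    (isSeparated_finiteQuotient_hom _ hcov') hq

end FiniteQuotient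

end Literature.AlgebraicGeometry.Motives

end
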